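import Mathlib
import HarnessLib
import Summits.HubbardSuperconductivity.HubbardSuperconductivity.Theorems.KLProgrammeKLRegimeSectorMultiplierOverlapWtFlowDeep
import Summits.HubbardSuperconductivity.HubbardSuperconductivity.Theorems.KLProgrammeKLRegimeEngineTowerModelDefsRate

/-!
# K3 ENGINE child (stmt-HubbardSuperconductivity-20437), stub (b), the LEVELS package (ℓ): the WEIGHTED overlap constants `cr/cc` at ANY WEAKER RATE and
# IN THE TOWER'S INDEXING — `hrow′/hcol′` of `klWtPinnedSumAt_klTowerIncr_le` (…EngineTowerBlockIncrWtRate: thin `F_{J′}`, fat `F̃_{dk−1}`, weight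
# `klScaleWt j`, `dk ≤ J′ ≤ j`) at the flow frame `K_n`, ONE constant per `d′`

Cell `gate-hubbard-kl`, seat p3 (g11); companions of `…AlphaWtBlockTower` (block `α`).  `overlapWt_jump_sums_klEng_flow_deep` (p585156) weighs the overlap of
`E(klAnisoFamily J′)·S(F̃_k)` at the thin level `J′` itself; the tower reads it at its read-out RATE `j ≥ J′` (E1 blueprint v5 §8, (K4) target-rate reading) —
a weaker weight, so the same constant serves (`klScaleWt_le_of_le`):

* **`overlapWt_jump_sums_klEng_flow_deep_rate (d′)`** — p585156's three conjuncts with the weight `klScaleWt L M β jw` for ANY `jw ≥ J′`;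
* **`overlapWt_towerBlock_klEng_flow_deep (d d′)`** — the same at fat index `d·k − 1`, thin `J′ ≥ d·k`, weight `jw ≥ J′`, window `4ⁿ·U ≤ 4^{2dk+d′}`: exactly E1's
  `hrow′/hcol′` (with `cr := 81·C_J·M/β`, per-pair sums `3·C_J·M/β`).

Everything is proved; no definitions; nothing about the model is asserted. [cite: BenfattoGiulianiMastropietro2006, §2.7 (2.71a), §2.8 (2.77), (2.82)–(2.83)]
-/

noncomputable section

namespace Summit.HubbardSuperconductivity.HubbardSuperconductivity.Theorems.TorusFourierL2

set_option linter.dupNamespace false -- summit = problem name (single-conjunct summit), D-0017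

open Set Finset Literature.MathematicalPhysics.QuantumLattice Literature.MathematicalPhysics.QuantumLattice.BandSectorCounting
open Literature.MathematicalPhysics.QuantumLattice.FermiRG Literature.Probability.LatticeModels Literature.Analysis.SpecialFunctions
open Summit.HubbardSuperconductivity.HubbardSuperconductivity.Theorems.DispersionFlow
open Summit.HubbardSuperconductivity.HubbardSuperconductivity.Theorems.KLRegimeSplit
open Summit.HubbardSuperconductivity.HubbardSuperconductivity.Theorems.KLProgrammeLegKernels
open Summit.HubbardSuperconductivity.HubbardSuperconductivity.Theorems.PerturbedFermiCurve
open scoped Real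

open Classical

/-- **The weighted overlap constants at any weaker rate `jw ≥ J′`** (see the module docstring). [cite: BenfattoGiulianiMastropietro2006, §2.7 (2.71a), §2.8 (2.77)] -/
theorem overlapWt_jump_sums_klEng_flow_deep_rate (dd : ℕ) :
    ∃ CJ : ℝ, 0 < CJ ∧
      ∀ (G : GeoConsts) (P : SplitConsts) (R : RenConsts) (Q : EngConsts) (cc : ℝ), R.WF2 → 0 < cc → cc ≤ EngineV8.klEngC₃6 P R →
      ∀ μ ∈ klWindowC, ∀ U : ℝ, 0 < U → U ≤ min (EngineV8.klEngU₀3 P R cc) (1 / (R.Gfr 3 + 1)) →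
      ∀ β : ℝ, klBetaMin ≤ β → β ≤ Real.exp (cc / U ^ 2) →
      ∀ (L M : ℕ) [NeZero L] [NeZero M], EngineV8.klEngL₃ β U ≤ L → EngineV8.klEngM₃ β U L ≤ M →
      ∀ n : ℕ, 1 ≤ n → n ≤ nScales β + 1 →
        HistP klPredsV17F2 L M G P Q R β U μ 0 n → FrameOK R U (nScales β) μ (klFlowFrameU L M β U μ n) →
        ∀ k J' : ℕ, k + 1 ≤ J' → J' ≤ n → (4 : ℝ) ^ n * U ≤ (4 : ℝ) ^ (2 * (k + 1) + dd) → ∀ jw : ℕ, J' ≤ jw →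
        (∀ X'' : SpaceTimeIdx L M × SectorLeg (sectorCount J'),
          ∑ X', ‖(sectorAnalysisMatrix L M β (klAnisoFamily L M β μ (klFlowFrameU L M β U μ n) klE0 J') *
            sectorSubMatrix L M β (bgmFatMultiplier L M klE0 β (nambuXiCT L μ (klFlowFrameU L M β U μ n)) k)) X'' X'‖ *
              EngineV8.klScaleWt L M β jw {EngineV8.latticeLegPos (2 * (2 * M)) X'', EngineV8.latticeLegPos (2 * (2 * M)) X'} ≤
            81 * CJ * M / β) ∧
        (∀ (ω'' : Fin (sectorCount J')) (ω' : Fin (sectorCount k)) (σ c : Fin 2) (x' : SpaceTimeIdx L M),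
          ∑ x'' : SpaceTimeIdx L M, ‖(sectorAnalysisMatrix L M β (klAnisoFamily L M β μ (klFlowFrameU L M β U μ n) klE0 J') *
            sectorSubMatrix L M β (bgmFatMultiplier L M klE0 β (nambuXiCT L μ (klFlowFrameU L M β U μ n)) k))
              (x'', ((ω'', σ), c)) (x', ((ω', σ), c))‖ *
              EngineV8.klScaleWt L M β jw
                {EngineV8.latticeLegPos (2 * (2 * M)) ((x'', ((ω'', σ), c)) : SpaceTimeIdx L M × SectorLeg (sectorCount J')),
                  EngineV8.latticeLegPos (2 * (2 * M)) ((x', ((ω', σ), c)) : SpaceTimeIdx L M × SectorLeg (sectorCount k))} ≤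
            3 * CJ * M / β) ∧
        (∀ (ω'' : Fin (sectorCount J')) (ω' : Fin (sectorCount k)) (σ c : Fin 2) (x'' : SpaceTimeIdx L M),
          ∑ x' : SpaceTimeIdx L M, ‖(sectorAnalysisMatrix L M β (klAnisoFamily L M β μ (klFlowFrameU L M β U μ n) klE0 J') *
            sectorSubMatrix L M β (bgmFatMultiplier L M klE0 β (nambuXiCT L μ (klFlowFrameU L M β U μ n)) k))
              (x'', ((ω'', σ), c)) (x', ((ω', σ), c))‖ *
              EngineV8.klScaleWt L M β jw
                {EngineV8.latticeLegPos (2 * (2 * M)) ((x'', ((ω'', σ), c)) : SpaceTimeIdx L M × SectorLeg (sectorCount J')),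
                  EngineV8.latticeLegPos (2 * (2 * M)) ((x', ((ω', σ), c)) : SpaceTimeIdx L M × SectorLeg (sectorCount k))} ≤
            3 * CJ * M / β) := by
  obtain ⟨CJ, hCJ, h⟩ := overlapWt_jump_sums_klEng_flow_deep dd
  refine ⟨CJ, hCJ, ?_⟩
  intro G P R Q cc hR2 hcc hcc6 μ hμ U hU hUle β hβmin hβc L M _ _ hL3 hM3 n hn1 hnN hhist hfr k J' hJ hJn hnd jw hjw
  obtain ⟨hrow, hcol₁, hrow₁⟩ := h G P R Q cc hR2 hcc hcc6 μ hμ U hU hUle β hβmin hβc L M hL3 hM3 n hn1 hnN hhist hfr k J' hJ hJn hnd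
  have hwt : ∀ T : Finset (ZMod (2 * (2 * M)) × TorusSite 2 L), EngineV8.klScaleWt L M β jw T ≤ EngineV8.klScaleWt L M β J' T :=
    fun T => EngineV8.klScaleWt_le_of_le β hjw T
  refine ⟨fun X'' => ?_, fun ω'' ω' σ c x' => ?_, fun ω'' ω' σ c x'' => ?_⟩
  · exact (Finset.sum_le_sum fun X' _ => mul_le_mul_of_nonneg_left (hwt _) (norm_nonneg _)).trans (hrow X'')
  · exact (Finset.sum_le_sum fun x'' _ => mul_le_mul_of_nonneg_left (hwt _) (norm_nonneg _)).trans (hcol₁ ω'' ω' σ c x')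
  · exact (Finset.sum_le_sum fun x' _ => mul_le_mul_of_nonneg_left (hwt _) (norm_nonneg _)).trans (hrow₁ ω'' ω' σ c x'')


/-- **The weighted overlap constants in the tower's indexing** (fat `d·k − 1`, thin `J′ ≥ d·k`, weight `jw ≥ J′`; see the module docstring).
[cite: BenfattoGiulianiMastropietro2006, §2.7 (2.71a), §2.8 (2.77)] -/
theorem overlapWt_towerBlock_klEng_flow_deep (d dd : ℕ) :
    ∃ CJ : ℝ, 0 < CJ ∧
      ∀ (G : GeoConsts) (P : SplitConsts) (R : RenConsts) (Q : EngConsts) (cc : ℝ), R.WF2 → 0 < cc → cc ≤ EngineV8.klEngC₃6 P R →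
      ∀ μ ∈ klWindowC, ∀ U : ℝ, 0 < U → U ≤ min (EngineV8.klEngU₀3 P R cc) (1 / (R.Gfr 3 + 1)) →
      ∀ β : ℝ, klBetaMin ≤ β → β ≤ Real.exp (cc / U ^ 2) →
      ∀ (L M : ℕ) [NeZero L] [NeZero M], EngineV8.klEngL₃ β U ≤ L → EngineV8.klEngM₃ β U L ≤ M →
      ∀ n : ℕ, 1 ≤ n → n ≤ nScales β + 1 →
        HistP klPredsV17F2 L M G P Q R β U μ 0 n → FrameOK R U (nScales β) μ (klFlowFrameU L M β U μ n) →
        ∀ k : ℕ, 1 ≤ d * k → ∀ J' : ℕ, d * k ≤ J' → J' ≤ n → (4 : ℝ) ^ n * U ≤ (4 : ℝ) ^ (2 * (d * k) + dd) → ∀ jw : ℕ, J' ≤ jw →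
        (∀ X'' : SpaceTimeIdx L M × SectorLeg (sectorCount J'),
          ∑ X', ‖(sectorAnalysisMatrix L M β (klAnisoFamily L M β μ (klFlowFrameU L M β U μ n) klE0 J') *
            sectorSubMatrix L M β (bgmFatMultiplier L M klE0 β (nambuXiCT L μ (klFlowFrameU L M β U μ n)) (d * k - 1))) X'' X'‖ *
              EngineV8.klScaleWt L M β jw {EngineV8.latticeLegPos (2 * (2 * M)) X'', EngineV8.latticeLegPos (2 * (2 * M)) X'} ≤
            81 * CJ * M / β) ∧
        (∀ (ω'' : Fin (sectorCount J')) (ω' : Fin (sectorCount (d * k - 1))) (σ c : Fin 2) (x' : SpaceTimeIdx L M),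
          ∑ x'' : SpaceTimeIdx L M, ‖(sectorAnalysisMatrix L M β (klAnisoFamily L M β μ (klFlowFrameU L M β U μ n) klE0 J') *
            sectorSubMatrix L M β (bgmFatMultiplier L M klE0 β (nambuXiCT L μ (klFlowFrameU L M β U μ n)) (d * k - 1)))
              (x'', ((ω'', σ), c)) (x', ((ω', σ), c))‖ *
              EngineV8.klScaleWt L M β jw
                {EngineV8.latticeLegPos (2 * (2 * M)) ((x'', ((ω'', σ), c)) : SpaceTimeIdx L M × SectorLeg (sectorCount J')),
                  EngineV8.latticeLegPos (2 * (2 * M)) ((x', ((ω', σ), c)) : SpaceTimeIdx L M × SectorLeg (sectorCount (d * k - 1)))} ≤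
            3 * CJ * M / β) ∧
        (∀ (ω'' : Fin (sectorCount J')) (ω' : Fin (sectorCount (d * k - 1))) (σ c : Fin 2) (x'' : SpaceTimeIdx L M),
          ∑ x' : SpaceTimeIdx L M, ‖(sectorAnalysisMatrix L M β (klAnisoFamily L M β μ (klFlowFrameU L M β U μ n) klE0 J') *
            sectorSubMatrix L M β (bgmFatMultiplier L M klE0 β (nambuXiCT L μ (klFlowFrameU L M β U μ n)) (d * k - 1)))
              (x'', ((ω'', σ), c)) (x', ((ω', σ), c))‖ *
              EngineV8.klScaleWt L M β jw
                {EngineV8.latticeLegPos (2 * (2 * M)) ((x'', ((ω'', σ), c)) : SpaceTimeIdx L M × SectorLeg (sectorCount J')),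
                  EngineV8.latticeLegPos (2 * (2 * M)) ((x', ((ω', σ), c)) : SpaceTimeIdx L M × SectorLeg (sectorCount (d * k - 1)))} ≤
            3 * CJ * M / β) := by
  obtain ⟨CJ, hCJ, h⟩ := overlapWt_jump_sums_klEng_flow_deep_rate dd
  refine ⟨CJ, hCJ, ?_⟩
  intro G P R Q cc hR2 hcc hcc6 μ hμ U hU hUle β hβmin hβc L M _ _ hL3 hM3 n hn1 hnN hhist hfr k hdk J' hJ' hJn hnd jw hjw
  have e1 : d * k - 1 + 1 = d * k := by omega
  have h' := h G P R Q cc hR2 hcc hcc6 μ hμ U hU hUle β hβmin hβc L M hL3 hM3 n hn1 hnN hhist hfr (d * k - 1) J' (by omega) hJn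
    (by rw [e1]; exact hnd) jw hjw
  exact h'

end Summit.HubbardSuperconductivity.HubbardSuperconductivity.Theorems.TorusFourierL2

end
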